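import Summits.CriticalPhenomena.PercolationContinuityZ3.Theorems.Transplant.Slab111VResid
import HarnessLib

/-!
# The routing certificate for `ShapedLinkage 3 (Slab111.hexShadow k)`, IX: certified TERMINALS land in the need list

builds on p205010 (kernel theorem, internal audit signed; external expert review pending) — NOT used in this file.  Lane `prim-bschramm`, seat
`prim-bschramm-p2` (gen 35; class C1b; memo `HOME/bschramm/P2-LATTICES.md` §129); helper file (`--supports stmt-CriticalPhenomena-4575 --as helper`).
For a block of the `(111)`-film with centre `z` and node parameters `tR ≤ tD`, `sR ≤ sD`, the REDUCED KEY is `rkey tR tD sR sD` and the cleared set is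
`Wset` of «Slab111VShapes» at the reduced key.  Given terminals certified by `HexShadow.Terminals 3 z tR tD sR W E₁ E₂ w'` («HexShadowVRouteData»), their
relative columns form a configuration of `Srch.configs` and their statuses an item of `Srch.needItems` («Slab111VSearch») — so the kernel certificate
applies to them.
* §1 the reduced key, block tests, the window, statuses; * §2 `ecandSt`/`wcandSt` of certified terminals; * §3 `realizableItem` (the witness conditions);
* §4 **`item_mem_needItems`**, **`cfg_mem_configs`**.
[cite: DuminilCopinSidoraviciusTassion2016, §2.3 (proof of Fact 2: u', v', w')]
-/

noncomputable section

namespace Summit.CriticalPhenomena.PercolationContinuityZ3.Theorems.Transplant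

open Literature.Probability.Percolation Literature.Probability.LatticeModels SimpleGraph
open scoped Classical

namespace Slab111

variable {k : ℕ}

/-! ## §1 The reduced key and basic translations -/

/-- **The reduced block type** of node parameters: clips capped at `3`, the cleared block at most one column beyond the rerouting block. [folklore] -/
def rkey (tR tD sR sD : ℕ) : BKey := ⟨cap3 tR, min (cap3 tD) (cap3 tR + 1), cap3 sR, min (cap3 sD) (cap3 sR + 1)⟩

/-- Coordinate test from membership in a clipped block of radius `3` (clips capped). [folklore] -/
theorem inBlkB_cap_of_mem_blkR {z w : Site 2} {t s : ℕ} (h : w ∈ blkR 3 z t s) : inBlkB (cap3 t) (cap3 s) (w 0 - z 0, w 1 - z 1) = true := by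
  rw [blkR_three] at h
  obtain ⟨h1, h2, h3⟩ := h
  rw [mem_hexBall] at h1
  simp only [triNorm, Pi.sub_apply, max_le_iff, abs_le] at h1
  simp only [inBlkB, tnZ, Bool.and_eq_true, decide_eq_true_eq, cap3, Nat.cast_min, Nat.cast_ofNat, max_le_iff, abs_le]
  refine ⟨⟨⟨⟨?_, ?_⟩, ⟨?_, ?_⟩, ?_, ?_⟩, ?_⟩, ?_⟩ <;> omega

/-- The relative column of a vertex over a radius-`3` block is a hexagon column. [folklore] -/
theorem rcol_mem_hexCols {c : Col} (h : tnZ c ≤ 3) : c ∈ Srch.hexCols := by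
  obtain ⟨a, b⟩ := c
  simp only [tnZ, max_le_iff, abs_le] at h
  obtain ⟨⟨ha1, ha2⟩, ⟨hb1, hb2⟩, hab1, hab2⟩ := h
  simp only [Srch.hexCols]
  interval_cases a <;> interval_cases b <;> simp_all

/-- `inBlkB` gives the hexagon bound. [folklore] -/
theorem tnZ_le_of_inBlkB {t s : ℕ} {c : Col} (h : inBlkB t s c = true) : tnZ c ≤ 3 := by
  simp only [inBlkB, Bool.and_eq_true, decide_eq_true_eq] at h; exact h.1.1

/-- **The model window test from the real window** (reduced key). [folklore] -/
theorem inWinB_rkey {z : Site 2} {tR tD sR sD : ℕ} {q c : Col} (hc : c.1 ≤ ((cap3 tR : ℕ) : ℤ)) (hqc : q.1 ≤ c.1 + 1)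
    (hw : HexShadow.InWin z tD sR (vcol z q)) : Srch.inWinB (rkey tR tD sR sD) q = true := by
  obtain ⟨h1, h2⟩ := hw
  simp only [vcol_apply_zero, vcol_apply_one] at h1 h2
  simp only [Srch.inWinB, rkey, cap3, Bool.and_eq_true, Bool.or_eq_true, beq_iff_eq, decide_eq_true_eq]
  simp only [cap3] at hc
  push_cast at hc ⊢
  constructor
  · by_cases h3 : min (min (tD : ℤ) 3) (min (tR : ℤ) 3 + 1) = 3
    · left; exact_mod_cast (by push_cast; omega : ((min (min tD 3) (min tR 3 + 1) : ℕ) : ℤ) = 3)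
    · right; omega
  · by_cases h3 : min (sR : ℤ) 3 = 3
    · left; exact_mod_cast (by push_cast; omega : ((min sR 3 : ℕ) : ℤ) = 3)
    · right; omega

/-- Statuses are among the seven. [folklore] -/
theorem statusOf_mem_STATUSES (_hk : 5 ≤ k) {h : ℤ} (h0 : 0 ≤ h) (hh : h ≤ k) : statusOf k h ∈ Srch.STATUSES := by
  unfold statusOf Srch.STATUSES
  split_ifs with h2 h3
  · interval_cases h <;> simp
  · have : (12 - ((k : ℤ) - h)).toNat = 10 ∨ (12 - ((k : ℤ) - h)).toNat = 11 ∨ (12 - ((k : ℤ) - h)).toNat = 12 := by omega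
    rcases this with e | e | e <;> simp [e]
  · simp

/-- The level of an extended status near a boundary. [folklore] -/
def levOfExt (k : ℕ) (σ : ℤ) : ℤ := if σ ≤ 3 then σ else (k : ℤ) - (12 - σ)

/-- An exact status pins its level. [folklore] -/
theorem lev_eq_levOfExt (_hk : 5 ≤ k) {h : ℤ} (h0 : 0 ≤ h) (hh : h ≤ k) (hex : statusOf k h ≠ 9) : h = levOfExt k (statusOf k h) := by
  unfold levOfExt statusOf at *; split_ifs at hex ⊢ <;> omega

/-- The neighbour levels of an exact terminal are pinned by their extended statuses. [folklore] -/
theorem nbr_lev_eq_levOfExt (_hk : 10 ≤ k) {h : ℤ} (h0 : 0 ≤ h) (hh : h ≤ k) (hex : statusOf k h ≠ 9) (up : Bool)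
    (hr : if up then h + 1 ≤ k else 1 ≤ h) :
    (if up then h + 1 else h - 1) = levOfExt k (Srch.nbrStatus (statusOf k h) up) := by
  cases up <;> simp only [Bool.false_eq_true, if_false, if_true] at hr ⊢ <;> unfold levOfExt Srch.nbrStatus statusOf at * <;>
    simp only [Bool.false_eq_true, if_false, if_true] <;> split_ifs at hex ⊢ <;> omega

/-! ## §2 Candidacy of certified terminals -/

/-- The model neighbour pair of a real neighbour `o` of a terminal `X` (column `c`, level `h`). [folklore] -/
theorem nbr_pair {z : Site 2} {X o : slab111 k} (hadj : (film k).Adj X o) :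
    ∃ u ∈ Srch.ups, ∃ up : Bool, rcol z o = (if up then ((rcol z X).1 + u.1, (rcol z X).2 + u.2) else ((rcol z X).1 - u.1, (rcol z X).2 - u.2)) ∧
      lev (o : Site 3) = (if up then lev (X : Site 3) + 1 else lev (X : Site 3) - 1) := by
  obtain ⟨u, hu, h | h⟩ := adj_model (z := z) hadj
  · exact ⟨u, hu, true, by simpa using h.1, by simpa using h.2⟩
  · exact ⟨u, hu, false, by simpa using h.1, by simpa using h.2⟩

/-- A model neighbour pair lies in the (unfiltered) neighbour list of the model. [folklore] -/
theorem mem_nbList {c : Col} {s : ℤ} {u : Col} (hu : u ∈ Srch.ups) (up : Bool) :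
    ((if up then (c.1 + u.1, c.2 + u.2) else (c.1 - u.1, c.2 - u.2)), Srch.nbrStatus s up) ∈
      (Srch.ups.flatMap fun u => [((c.1 + u.1, c.2 + u.2), Srch.nbrStatus s true), ((c.1 - u.1, c.2 - u.2), Srch.nbrStatus s false)]) := by
  rw [List.mem_flatMap]
  refine ⟨u, hu, ?_⟩
  cases up <;> simp

/-- Bounds of a represented status. [folklore] -/
theorem bounds_of_repLevel {s L : ℤ} (h : RepLevel k s L) (h0 : 0 ≤ L) (hL : L ≤ k) : 0 ≤ s ∧ s ≤ 12 := by
  unfold RepLevel at h; omega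

/-- **The outside-neighbour clause**: a neighbour outside `W` inside the window is seen by the model. [folklore] -/
theorem any_outside {z : Site 2} {tR tD sR sD : ℕ} (hk : 10 ≤ k) {X o : slab111 k} (hadj : (film k).Adj X o)
    (ho : o ∉ Wset k z (rkey tR tD sR sD).tR (rkey tR tD sR sD).tD (rkey tR tD sR sD).sR (rkey tR tD sR sD).sD)
    (hwin : HexShadow.InWin z tD sR (sh o)) (hcR : (rcol z X).1 ≤ ((cap3 tR : ℕ) : ℤ)) :
    (Srch.ups.any fun u =>
      (decide (Srch.nbrStatus (statusOf k (lev (X : Site 3))) true ≤ 12) && Srch.inWinB (rkey tR tD sR sD) ((rcol z X).1 + u.1, (rcol z X).2 + u.2) &&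
          !Srch.inWs (CtxT.of (Ctx.of (rkey tR tD sR sD) (cls z) (k % 3))) ((rcol z X).1 + u.1, (rcol z X).2 + u.2) (Srch.nbrStatus (statusOf k (lev (X : Site 3))) true)) ||
      (decide (0 ≤ Srch.nbrStatus (statusOf k (lev (X : Site 3))) false) && Srch.inWinB (rkey tR tD sR sD) ((rcol z X).1 - u.1, (rcol z X).2 - u.2) &&
          !Srch.inWs (CtxT.of (Ctx.of (rkey tR tD sR sD) (cls z) (k % 3))) ((rcol z X).1 - u.1, (rcol z X).2 - u.2) (Srch.nbrStatus (statusOf k (lev (X : Site 3))) false))) = true := by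
  set c := rcol z X
  set h := lev (X : Site 3)
  have hX0 : 0 ≤ h ∧ h ≤ k := ⟨(exists_eq_vl X).1.2.1, (exists_eq_vl X).1.2.2⟩
  have ho0 : 0 ≤ lev (o : Site 3) ∧ lev (o : Site 3) ≤ k := ⟨(exists_eq_vl o).1.2.1, (exists_eq_vl o).1.2.2⟩
  obtain ⟨u, hu, up, hcol, hlev⟩ := nbr_pair (z := z) hadj
  have hu1 : -1 ≤ u.1 ∧ u.1 ≤ 1 := by
    have := hu; simp only [Srch.ups, List.mem_cons, List.not_mem_nil, or_false] at this
    rcases this with rfl | rfl | rfl <;> simp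
  rw [List.any_eq_true]
  refine ⟨u, hu, ?_⟩
  have hsho : sh o = vcol z (rcol z o) := sh_eq_vcol_rcol z o
  rw [hsho] at hwin
  cases up
  · -- down neighbour
    simp only [Bool.false_eq_true, if_false] at hcol hlev
    have h1 : 1 ≤ h := by omega
    have hrep := repLevel_nbr_down hk h1 hX0.2
    rw [Bool.or_eq_true]; right
    simp only [Bool.and_eq_true, decide_eq_true_eq, Bool.not_eq_true']
    refine ⟨⟨(bounds_of_repLevel hrep (by omega) (by omega)).1, ?_⟩, ?_⟩
    · rw [hcol] at hwin; exact inWinB_rkey hcR (by simp only; omega) hwin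
    · by_contra hin
      rw [Bool.not_eq_false] at hin
      exact ho (mem_W_of_inWs hk hin (by rw [hsho, hcol]) hlev hrep)
  · -- up neighbour
    simp only [if_true] at hcol hlev
    have h1 : h + 1 ≤ k := by omega
    have hrep := repLevel_nbr_up hk hX0.1 h1
    rw [Bool.or_eq_true]; left
    simp only [Bool.and_eq_true, decide_eq_true_eq, Bool.not_eq_true']
    refine ⟨⟨(bounds_of_repLevel hrep (by omega) (by omega)).2, ?_⟩, ?_⟩
    · rw [hcol] at hwin; exact inWinB_rkey hcR (by simp only; omega) hwin
    · by_contra hin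
      rw [Bool.not_eq_false] at hin
      exact ho (mem_W_of_inWs hk hin (by rw [hsho, hcol]) hlev hrep)

/-- **A certified `E`-terminal is an `E`-candidate of the model.** [folklore] -/
theorem ecandSt_of_terminal {z : Site 2} {tR tD sR sD : ℕ} (hk : 10 ≤ k) {X o : slab111 k}
    (hX : X ∈ Wset k z (rkey tR tD sR sD).tR (rkey tR tD sR sD).tD (rkey tR tD sR sD).sR (rkey tR tD sR sD).sD) (hXR : sh X ∈ blkR 3 z tR sR)
    (hXz : sh X ≠ z) (hadj : (film k).Adj X o)
    (ho : o ∉ Wset k z (rkey tR tD sR sD).tR (rkey tR tD sR sD).tD (rkey tR tD sR sD).sR (rkey tR tD sR sD).sD) (hwin : HexShadow.InWin z tD sR (sh o)) :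
    Srch.ecandSt (CtxT.of (Ctx.of (rkey tR tD sR sD) (cls z) (k % 3))) (rcol z X) (statusOf k (lev (X : Site 3))) = true := by
  have hX0 : 0 ≤ lev (X : Site 3) ∧ lev (X : Site 3) ≤ k := ⟨(exists_eq_vl X).1.2.1, (exists_eq_vl X).1.2.2⟩
  have hbR := inBlkB_cap_of_mem_blkR hXR
  have hsh := sh_eq_vcol_rcol z X
  have hcR : (rcol z X).1 ≤ ((cap3 tR : ℕ) : ℤ) := by
    simp only [inBlkB, Bool.and_eq_true, decide_eq_true_eq] at hbR; exact hbR.1.2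
  have hstat := bounds_of_repLevel (repLevel_statusOf (by omega) hX0.1 hX0.2) hX0.1 hX0.2 (k := k)
  unfold Srch.ecandSt
  simp only [Bool.and_eq_true, Bool.not_eq_true', beq_eq_false_iff_ne, ne_eq]
  refine ⟨⟨?_, ?_⟩, any_outside hk hadj ho hwin hcR⟩
  · simp only [Srch.inWRs, Bool.and_eq_true]
    refine ⟨inWs_of_mem_W hk hX hsh (by exact_mod_cast hstat.1) (by exact_mod_cast hstat.2) (repLevel_statusOf (by omega) hX0.1 hX0.2), ?_⟩
    simpa [rkey, Ctx.of, rcol] using hbR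
  · intro h0
    apply hXz
    rw [hsh, h0]; ext i; fin_cases i <;> simp [vcol]

/-- **A cleared `w'` off the centre column is a `w'`-candidate of the model.** [folklore] -/
theorem wcandSt_of_terminal {z : Site 2} {tR tD sR sD : ℕ} (hk : 10 ≤ k) {X : slab111 k}
    (hX : X ∈ Wset k z (rkey tR tD sR sD).tR (rkey tR tD sR sD).tD (rkey tR tD sR sD).sR (rkey tR tD sR sD).sD) (hXz : sh X ≠ z) :
    Srch.wcandSt (CtxT.of (Ctx.of (rkey tR tD sR sD) (cls z) (k % 3))) (rcol z X) (statusOf k (lev (X : Site 3))) = true := by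
  have hX0 : 0 ≤ lev (X : Site 3) ∧ lev (X : Site 3) ≤ k := ⟨(exists_eq_vl X).1.2.1, (exists_eq_vl X).1.2.2⟩
  have hsh := sh_eq_vcol_rcol z X
  have hstat := bounds_of_repLevel (repLevel_statusOf (by omega) hX0.1 hX0.2) hX0.1 hX0.2 (k := k)
  unfold Srch.wcandSt
  simp only [Bool.and_eq_true, Bool.not_eq_true', beq_eq_false_iff_ne, ne_eq]
  refine ⟨inWs_of_mem_W hk hX hsh (by exact_mod_cast hstat.1) (by exact_mod_cast hstat.2) (repLevel_statusOf (by omega) hX0.1 hX0.2), ?_⟩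
  intro h0; apply hXz; rw [hsh, h0]; ext i; fin_cases i <;> simp [vcol]

end Slab111

end Summit.CriticalPhenomena.PercolationContinuityZ3.Theorems.Transplant

end
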